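import Summits.BirchSwinnertonDyer.BirchSwinnertonDyer.Theorems.CMKolyvaginAtInertTwoLowerLevelTwoEngineDeepAtTwo
import Summits.BirchSwinnertonDyer.BirchSwinnertonDyer.Theorems.CMKolyvaginAtInertTwoLowerLevelTwoTransverseAtTwo
import Summits.BirchSwinnertonDyer.BirchSwinnertonDyer.Theorems.CMKolyvaginAtInertTwoLowerClosureAtTwo
import Summits.BirchSwinnertonDyer.BirchSwinnertonDyer.Theorems.CMKolyvaginAtInertTwoFrobeniusBridgeAtTwo
import Summits.BirchSwinnertonDyer.BirchSwinnertonDyer.Theorems.GenusKolyvaginAtTwoPowDvdShaCardAtTwoRTBottomRungParity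
import Summits.BirchSwinnertonDyer.BirchSwinnertonDyer.Theorems.CMKolyvaginAtInertTwoLowerLevelTwoGenusPlaceAtTwo
import Summits.BirchSwinnertonDyer.Rank1Residual.P2.CMKolyvaginRationalDescentPlumbingAtTwo
import HarnessLib

/-!
# Route `CMKolyvaginAtInertTwo`, crux `CMKolyvaginExactAtInertTwo` (stmt-BirchSwinnertonDyer-24277), `stub_lower` — W-UP on H₂,
# FILE W4c‴: THE WITNESS UPGRADE WITH THE GENUS PLACE ABSTRACT (any odd `d_K`)

Seat `bsd-line-cmk2-p1` g21 (cell `bsd-print-cf2`), `--supports stmt-BirchSwinnertonDyer-24277` (helper; closes nothing).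
THEOREMS ONLY (no definition, no named fact, no `sorry`).  BSD is NOT proved by any of this; the crux is not closed here.
g19's file W4c `exists_deep_primitive_two_of_certificate` (shallow certificate ⟹ all-deep primitive product, by the `k`-minimal
choice and the level-`2` swap engine W4b) uses «`|d_K|` PRIME» at exactly three points: to name the genus place `u`, to bound
`#H¹(ℚ_u, E[2]) ≤ 4` (W4c′) and to supply (desc-fin) off `u` (ty2); own primes avoid `u` since Kolyvagin primes do not divide
`d_K`.  THIS FILE is that proof VERBATIM with the three inputs as hypotheses (`q ∣ d_K` prime, `u` its place, `hPu`, `hdesc`), so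
that composite Heegner fields with one-bit genus defect `Σ ≤ 1` (file W4c″ `exists_genusPlace_of_sum_defect_le_one`) run the
same engine (g20's RESTATE-24277 option R1′).  `exists_deep_primitive_two_of_certificate_of_genusPlace` — modulo the named fact
`prop37_2_reductionCongruence_inert N_E W K` only.  References: [McCallumLMS1991] §4 Prop. 4.4, Cor. 4.5, §5 proof of Prop. 5.2;
[GrossLMS1991] Prop. 3.7 (2), Prop. 6.2, §9; [Kolyvagin1991MathAnn] Thm. 2.2; [Kramer1981] Prop. 3; [MilneADT2006] I Thm. 4.10.
-/

set_option autoImplicit false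
-- the Theorems namespace of this sub repeats the summit name by design (D-0017 nested layout)
set_option linter.dupNamespace false

noncomputable section

open scoped Classical

open Field NumberField IsDedekindDomain Function WeierstrassCurve Rat.HeightOneSpectrum
open Literature.NumberTheory.EllipticCurves
open Literature.NumberTheory.GaloisRepresentations
open Literature.NumberTheory.GaloisCohomology
open Literature.NumberTheory.EllipticCurves.GrossLMS1991 (prop37_2_reductionCongruence_inert)
open Summit.BirchSwinnertonDyer.Rank1Residual.X11b.Relaxation
open Summit.BirchSwinnertonDyer.Rank1Residual (X11b.KolyvaginAssembly.discr_lt_neg_four JET.exists_compatible_data_of_grossCM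
  JET.exists_compatible_datum_of_dvd_of_grossCM)
open Summit.BirchSwinnertonDyer.BirchSwinnertonDyer.Theorems.GenusExact
open Summit.BirchSwinnertonDyer.BirchSwinnertonDyer.Theorems.GenusExact.RelaxedCount
open Summit.BirchSwinnertonDyer.BirchSwinnertonDyer.Theorems.GenusExact.SelmerDescent (inertiaDeg_eq_two_of_span_isPrime)
open Summit.BirchSwinnertonDyer.BirchSwinnertonDyer.Theorems.GenusExact.VisiblePairAtTwo
  (natCast_mem_primesEquiv_symm natGenerator_eq_of_natCast_prime_mem natCast_prime_mem_iff_eq liesOver_of_natCast_mem natCast_mem_of_liesOver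
    exists_natCast_mem intCast_notMem_of_not_dvd)

namespace Summit.BirchSwinnertonDyer.BirchSwinnertonDyer.Theorems.KolyvaginLowerTwo

/-- **THE WITNESS UPGRADE ON H₂ WITH THE GENUS PLACE ABSTRACT, modulo Gross 1991 Prop. 3.7 (2).**  `E ∈ H₂` (CM, `2` inert, `ρ̄_{E,2}`
onto, odd Tamagawa); `K` imaginary quadratic, `d_K` odd `≠ −3`, Heegner; `prop37_2 …`; a prime `q ∣ d_K`, its place `u`, the budget
`#H¹(ℚ_u, E[2]) ≤ 4` and (desc-fin) at every finite `v ≠ u`.  CERTIFICATE: square-free `n` of Zhang–Kolyvagin primes at `2` that are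
CM-inert (ANY index), a datum `d` with `P(n) ∉ 2E(K[n])`.  THEN: a square-free `n₀` ALL of whose primes are Zhang–Kolyvagin of index `≥ 2`
with `Frob = Frob_∞` on `K(E[4])`, and a datum `e₀` at `n₀` with `addOrderOf c₁(e₀) = 2` (g19's W4c verbatim, «`|d_K|` prime» displayed).
[cite: McCallumLMS1991, §5 proof of Prop. 5.2] [cite: GrossLMS1991, Prop. 3.7 (2), Prop. 6.2, §9] [cite: Kramer1981, Prop. 3] -/
theorem exists_deep_primitive_two_of_certificate_of_genusPlace (W : WeierstrassCurve ℚ) [W.IsElliptic] [W.IsGloballyMinimal]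
    [NeZero (W.conductorNorm ℤ)] (hCM : W.HasCM) (hin : Rank1Residual.CMInert W 2) (hρ2 : W.HasSurjectiveModNGaloisRep 2)
    (hT : Odd W.tamagawaProduct) {K : Type} [Field K] [NumberField K] (hK : IsImaginaryQuadratic K)
    (hodd : Odd (NumberField.discr K)) (h3 : NumberField.discr K ≠ -3)
    (hHe : SatisfiesHeegnerHypothesis (W.conductorNorm ℤ) K) (h37 : prop37_2_reductionCongruence_inert (W.conductorNorm ℤ) W K)
    -- the genus place, abstract
    {q : ℕ} (hqd : (q : ℤ) ∣ NumberField.discr K) (u : HeightOneSpectrum (𝓞 ℚ))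
    (hu : ((primesEquiv u : Nat.Primes) : ℕ) = q)
    (hPu : Nat.card (galoisCohomology ((W.torsionGaloisModule ((2 ^ 1 : ℕ) : ℤ)).toLocal (Sum.inr u : Place ℚ)) 1) ≤ 4)
    (hdesc : ∀ (ξ : galH1Torsion W ((2 ^ 1 : ℕ) : ℤ)) (v : HeightOneSpectrum (𝓞 ℚ)), v ≠ u →
      (∀ w : HeightOneSpectrum (𝓞 K), w.under (𝓞 ℚ) = v →
        resTorsion W K ((2 ^ 1 : ℕ) : ℤ) ξ ∈ selmerLocalKer (W.baseChange K) (w.adicCompletion K) ((2 ^ 1 : ℕ) : ℤ)) →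
      ξ ∈ selmerLocalKer W (v.adicCompletion ℚ) ((2 ^ 1 : ℕ) : ℤ))
    (Dt : ModularForms.ModularParametrizationData W (W.conductorNorm ℤ)) (β : ℤ) (ι : K →+* ℂ)
    [∀ j : ℕ, NumberField (ringClassField K ι j)]
    {n : ℕ} (d : KolyvaginHeegnerData Dt β ι n) (hn : Squarefree n)
    (hKoly : ∀ ℓ ∈ n.primeFactors, Zhang2014.IsKolyvaginPrime (W.conductorNorm ℤ) W K 2 ℓ ∧ Rank1Residual.CMInert W ℓ)
    (hPn : ¬ ∃ Q : (W.baseChange (ringClassField K ι n)).toAffine.Point, (2 : ℤ) • Q = d.derivedPoint) :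
    ∃ (n₀ : ℕ) (e₀ : KolyvaginHeegnerData Dt β ι n₀), Squarefree n₀ ∧
      (∀ q ∈ n₀.primeFactors, Zhang2014.IsKolyvaginPrime (W.conductorNorm ℤ) W K 2 q ∧ 2 ≤ Zhang2014.kolyvaginIndex W 2 q ∧
        FrobEqFrobInfty W K (2 ^ 2) q) ∧
      addOrderOf (e₀.kolyvaginClass Nat.prime_two 1) = 2 ^ 1 := by
  haveI : Fact (Nat.Prime 2) := ⟨Nat.prime_two⟩
  have h2K : Module.finrank ℚ K = 2 := hK.1
  have h4 : NumberField.discr K ≠ -4 := fun h ↦ by rw [h] at hodd; exact (Int.not_even_iff_odd.mpr hodd) ⟨-2, by norm_num⟩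
  have hD : NumberField.discr K < -4 := X11b.KolyvaginAssembly.discr_lt_neg_four hK ⟨h3, h4⟩
  have hΔ : W.Δ < 0 := KolyvaginEigenTwo.Δ_neg_of_cmInert_two W hCM hin hρ2
  have hsurj1 : W.HasSurjectiveModNGaloisRep ((2 : ℤ) ^ 1) := by simpa using hρ2
  have hGrossCM := phi_heegnerPointOfConductor_mem_range_map_ringClassField_holds (W.conductorNorm ℤ) W K
  -- `K = ℚ(θ)`, `θ² = d_K`; the conjugation `σ`
  obtain ⟨θ, hθ', hθsq⟩ := Literature.NumberTheory.QuadraticFields.Quadratic.exists_not_mem_range_sq_eq_discr (K := K) h2K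
  have hθ : θ ∉ (algebraMap ℚ K).range := fun ⟨q, hq⟩ ↦ hθ' ⟨q, hq⟩
  have hc : θ ^ 2 = algebraMap ℚ K (NumberField.discr K : ℤ) := hθsq
  set σ : K ≃ₐ[ℚ] K := sigmaQ K h2K hθ' hθsq with hσ_def
  have hσ : σ ≠ 1 := sigmaQ_ne_one K h2K hθ' hθsq
  have hL2 : ∀ P : (W.baseChange K).toAffine.Point, ((2 ^ 1 : ℕ) : ℤ) • P = 0 → P = 0 :=
    EigenClassesFinite.forall_zsmul_two_pow_baseChange_eq_zero_of_hasSurjectiveModNGaloisRep_two W K h2K hρ2 1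
  -- ### the genus place `u` is a hypothesis here (`hqd`, `hu`, `hPu`, `hdesc`)
  -- Kummer membership over `ℚ` from the `K`-side (archimedean vanishing + descent plumbing): file W4c′
  have hKO := fun (T : Finset (Place ℚ)) (Z : galoisCohomology (W.torsionGaloisModule ((2 ^ 1 : ℕ) : ℤ)) 1)
      (cZ : galH1Torsion (W.baseChange K) ((2 ^ 1 : ℕ) : ℤ)) (huT : (Sum.inr u : Place ℚ) ∈ T)
      (hZ : resTorsion W K ((2 ^ 1 : ℕ) : ℤ) Z = cZ) ↦
    mem_kummerOutside_two_of_resTorsion W hΔ u hdesc T huT Z hZ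
  -- the Selmer condition of a Kolyvagin class off its level (Gross 6.2 (1) at `2`, image-free leaf)
  have hSel : ∀ {m : ℕ} (hm : Squarefree m) (dm : KolyvaginHeegnerData Dt β ι m) (w : HeightOneSpectrum (𝓞 K)),
      (∀ q ∈ m.primeFactors, (q : 𝓞 K) ∉ w.asIdeal) →
      dm.kolyvaginClass Nat.prime_two 1 ∈ selmerLocalKer (W.baseChange K) (w.adicCompletion K) ((2 ^ 1 : ℕ) : ℤ) :=
    fun hm dm w hw ↦ Summit.BirchSwinnertonDyer.Rank1Residual.P2.TamagawaSelmerAtTwo.kolyvaginClass_mem_selmerLocalKer_two_pow_of_not_mem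
      dm hK hHe hT hm.ne_zero 1 w (natCast_notMem_of_forall_primeFactors (K := K) hm w fun q hq hqw ↦ hw q hq hqw)
  -- ### the predicates of the minimal choice
  let Gross : ℕ → Prop := fun q ↦ Zhang2014.IsKolyvaginPrime (W.conductorNorm ℤ) W K 2 q ∧ FrobEqFrobInfty W K 2 q
  let Deep : ℕ → Prop := fun q ↦ Zhang2014.IsKolyvaginPrime (W.conductorNorm ℤ) W K 2 q ∧ 2 ≤ Zhang2014.kolyvaginIndex W 2 q ∧
    FrobEqFrobInfty W K (2 ^ 2) q
  let P : Finset ℕ → Prop := fun S ↦ ∃ (m : ℕ) (e : KolyvaginHeegnerData Dt β ι m), Squarefree m ∧ m.primeFactors = S ∧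
    (∀ q ∈ m.primeFactors, Gross q) ∧ addOrderOf (e.kolyvaginClass Nat.prime_two 1) = 2 ^ 1
  let kk : Finset ℕ → ℕ := fun S ↦ (S.filter fun q ↦ ¬ Deep q).card
  -- the certificate is a `P`-set
  have hGr0 : ∀ q ∈ n.primeFactors, Gross q := fun q hq ↦
    ⟨(hKoly q hq).1, by
      have h := KolyvaginFrobeniusTwo.frobEqFrobInfty_two_of_cmInert W (K := K) hK hCM hin hρ2 (hKoly q hq).1 (hKoly q hq).2
      rwa [pow_one] at h⟩
  have hnK1 : ∀ q ∈ n.primeFactors, Zhang2014.IsKolyvaginPrime (W.conductorNorm ℤ) W K 2 q ∧ 1 ≤ Zhang2014.kolyvaginIndex W 2 q :=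
    fun q hq ↦ ⟨(hKoly q hq).1, (hKoly q hq).1.2.2.2.2.2⟩
  have he0 : addOrderOf (d.kolyvaginClass Nat.prime_two 1) = 2 ^ 1 :=
    addOrderOf_kolyvaginClass_two_eq_pow_of_not_two_dvd_single W hK hodd h3 hHe hρ2 Dt β ι (M := 1) le_rfl hn hnK1 d hPn
  have hex : ∃ k, ∃ S, P S ∧ kk S = k := ⟨_, n.primeFactors, ⟨n, d, hn, rfl, hGr0, he0⟩, rfl⟩
  obtain ⟨S, hPS, hkS⟩ := Nat.find_spec hex
  have hmin : ∀ S', P S' → kk S ≤ kk S' := fun S' h ↦ by rw [hkS]; exact Nat.find_min' hex ⟨S', h, rfl⟩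
  -- a class at a non-`P` set of Gross primes vanishes
  have hvan : ∀ {m : ℕ} (hm : Squarefree m) (e : KolyvaginHeegnerData Dt β ι m), (∀ q ∈ m.primeFactors, Gross q) →
      ¬ P m.primeFactors → e.kolyvaginClass Nat.prime_two 1 = 0 := fun hm e hGr hnot ↦ by
    by_contra hne
    exact hnot ⟨_, e, hm, rfl, hGr, addOrderOf_eq_two_pow_one_of_ne_zero W hne⟩
  -- ### case split on the minimal number of shallow primes
  by_cases hk0 : kk S = 0
  · obtain ⟨m, e, hm, hpf, hGr, he⟩ := hPS
    refine ⟨m, e, hm, fun q hq ↦ ?_, he⟩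
    have hdq : Deep q := by
      by_contra h
      have : q ∈ S.filter fun q ↦ ¬ Deep q := Finset.mem_filter.mpr ⟨hpf ▸ hq, h⟩
      rw [Finset.card_eq_zero.mp hk0] at this
      exact Finset.notMem_empty _ this
    exact hdq
  exfalso
  obtain ⟨q₀, hq₀⟩ := Finset.card_pos.mp (Nat.pos_of_ne_zero hk0)
  obtain ⟨hq₀S, hq₀d⟩ := Finset.mem_filter.mp hq₀
  obtain ⟨m, e, hm, hpf, hGr, he⟩ := hPS
  subst hpf
  have hm0 : m ≠ 0 := hm.ne_zero
  have hmK1 : ∀ q ∈ m.primeFactors, Zhang2014.IsKolyvaginPrime (W.conductorNorm ℤ) W K 2 q ∧ 1 ≤ Zhang2014.kolyvaginIndex W 2 q :=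
    fun q hq ↦ ⟨(hGr q hq).1, (hGr q hq).1.2.2.2.2.2⟩
  -- `kk` drops by one when a shallow prime is removed (and a deep one possibly added)
  have hkk_erase : ∀ {q : ℕ}, q ∈ m.primeFactors → ¬ Deep q → kk (m.primeFactors.erase q) + 1 = kk m.primeFactors := by
    intro q hq hqd
    change ((m.primeFactors.erase q).filter fun q ↦ ¬ Deep q).card + 1 = (m.primeFactors.filter fun q ↦ ¬ Deep q).card
    rw [Finset.filter_erase, Finset.card_erase_add_one]
    exact Finset.mem_filter.mpr ⟨hq, hqd⟩
  have hkk_insert : ∀ {q ℓ : ℕ}, q ∈ m.primeFactors → ¬ Deep q → Deep ℓ →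
      kk (insert ℓ (m.primeFactors.erase q)) + 1 = kk m.primeFactors := by
    intro q ℓ hq hqd hℓ
    rw [← hkk_erase hq hqd]
    change ((insert ℓ (m.primeFactors.erase q)).filter fun q ↦ ¬ Deep q).card + 1 = _
    rw [Finset.filter_insert, if_neg (not_not.mpr hℓ)]
  -- ### places of the own primes: shallow `s` and deep `t`
  let pl : ℕ → Place ℚ := fun q ↦ if hq : q.Prime then Sum.inr (primesEquiv.symm ⟨q, hq⟩) else Sum.inr (primesEquiv.symm ⟨2, Nat.prime_two⟩)
  have hpl : ∀ {q : ℕ} (hq : q.Prime), pl q = Sum.inr (primesEquiv.symm ⟨q, hq⟩) := fun hq ↦ by simp only [pl, dif_pos hq]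
  have hplmem : ∀ {q : ℕ} (hq : q.Prime), (q : 𝓞 ℚ) ∈ (primesEquiv.symm ⟨q, hq⟩ : HeightOneSpectrum (𝓞 ℚ)).asIdeal :=
    fun hq ↦ natCast_mem_primesEquiv_symm hq
  let s : Finset (Place ℚ) := (m.primeFactors.filter fun q ↦ ¬ Deep q).image pl
  let t : Finset (Place ℚ) := (m.primeFactors.filter fun q ↦ Deep q).image pl
  have hback : ∀ u' ∈ s ∪ t, ∃ q ∈ m.primeFactors, u' = pl q := by
    intro u' hu'
    rcases Finset.mem_union.mp hu' with hu' | hu'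
    · obtain ⟨q, hq, rfl⟩ := Finset.mem_image.mp hu'; exact ⟨q, (Finset.mem_filter.mp hq).1, rfl⟩
    · obtain ⟨q, hq, rfl⟩ := Finset.mem_image.mp hu'; exact ⟨q, (Finset.mem_filter.mp hq).1, rfl⟩
  have hpl_inj : ∀ {q q' : ℕ}, q.Prime → q'.Prime → pl q = pl q' → q = q' := by
    intro q q' hq hq' h
    rw [hpl hq, hpl hq'] at h
    have := congrArg (fun v : HeightOneSpectrum (𝓞 ℚ) ↦ (primesEquiv v : ℕ)) (Sum.inr_injective h)
    simpa using this
  have hmem_st : ∀ q ∈ m.primeFactors, pl q ∈ s ∪ t := by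
    intro q hq
    by_cases hd : Deep q
    · exact Finset.mem_union_right _ (Finset.mem_image.mpr ⟨q, Finset.mem_filter.mpr ⟨hq, hd⟩, rfl⟩)
    · exact Finset.mem_union_left _ (Finset.mem_image.mpr ⟨q, Finset.mem_filter.mpr ⟨hq, hd⟩, rfl⟩)
  -- the genus place is not an own place (own primes do not divide `d_K`)
  have hu_ne : ∀ q ∈ m.primeFactors, pl q ≠ Sum.inr u := by
    intro q' hq' h
    have hq'p : q'.Prime := Nat.prime_of_mem_primeFactors hq'
    rw [hpl hq'p] at h
    have h' : (primesEquiv.symm ⟨q', hq'p⟩ : HeightOneSpectrum (𝓞 ℚ)) = u := Sum.inr_injective h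
    have hqq : q' = q := by
      have := congrArg (fun v : HeightOneSpectrum (𝓞 ℚ) ↦ ((primesEquiv v : Nat.Primes) : ℕ)) h'
      simpa [hu] using this
    exact (hGr q' hq').1.2.2.1 (by rw [hqq]; exact hqd)
  have hus : (Sum.inr u : Place ℚ) ∉ s := fun h ↦ by
    obtain ⟨q', hq', h'⟩ := Finset.mem_image.mp h; exact hu_ne q' (Finset.mem_filter.mp hq').1 h'
  have hut : (Sum.inr u : Place ℚ) ∉ t := fun h ↦ by
    obtain ⟨q', hq', h'⟩ := Finset.mem_image.mp h; exact hu_ne q' (Finset.mem_filter.mp hq').1 h'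
  -- ### the engine's frame hypotheses
  have hst : Disjoint s t := by
    rw [Finset.disjoint_left]
    intro u' hus' hut'
    obtain ⟨q, hq, rfl⟩ := Finset.mem_image.mp hus'
    obtain ⟨q', hq', h⟩ := Finset.mem_image.mp hut'
    obtain ⟨hqn, hqd⟩ := Finset.mem_filter.mp hq
    obtain ⟨hq'n, hq'd⟩ := Finset.mem_filter.mp hq'
    have := hpl_inj (Nat.prime_of_mem_primeFactors hq'n) (Nat.prime_of_mem_primeFactors hqn) h
    exact hqd (this ▸ hq'd)
  have hs : s.Nonempty := ⟨pl q₀, Finset.mem_image.mpr ⟨q₀, Finset.mem_filter.mpr ⟨hq₀S, hq₀d⟩, rfl⟩⟩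
  have hTK : ∀ u' ∈ s ∪ t, ∃ (v : HeightOneSpectrum (𝓞 ℚ)) (ℓ : ℕ) (_ : Fact ℓ.Prime), u' = Sum.inr v ∧ ℓ ≠ 2 ∧ (ℓ : 𝓞 ℚ) ∈ v.asIdeal ∧
      W.HasGoodReductionAtPrime ℓ ∧ FrobEqFrobInfty W K 2 ℓ ∧ 1 ≤ Zhang2014.kolyvaginIndex W 2 ℓ ∧
      Zhang2014.IsKolyvaginPrime (W.conductorNorm ℤ) W K 2 ℓ := by
    intro u' hu'
    obtain ⟨q, hq, rfl⟩ := hback u' hu'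
    have hqp : q.Prime := Nat.prime_of_mem_primeFactors hq
    haveI : Fact q.Prime := ⟨hqp⟩
    obtain ⟨hKol, hFrob2⟩ := hGr q hq
    exact ⟨_, q, ⟨hqp⟩, hpl hqp, hKol.2.2.2.1, hplmem hqp, hasGoodReductionAtPrime_of_not_dvd_conductorNorm W hKol.2.1, hFrob2,
      hKol.2.2.2.2.2, hKol⟩
  -- ### the class `c₁(m)`: order `2`, eigen; its descent `b`
  set cK := e.kolyvaginClass Nat.prime_two 1 with hcK_def
  obtain ⟨hsgn, hτcK⟩ := KolyvaginClassSign.sign_conjAct_kolyvaginClass_two hK h3 h4 hodd hHe hsurj1 σ hσ Dt β ι hm le_rfl hmK1 e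
  -- mod `2` the sign is invisible: `cK` is `σ`-fixed, hence a restriction from `ℚ`
  obtain ⟨b, hb⟩ := (EigenClassesFinite.mem_range_resTorsion_iff_conjAct_eq W K h2K hθ' hθsq _ hL2 cK).mpr
    (conjAct_eq_self_of_sign_two W σ cK hsgn hτcK)
  have hb0 : b ≠ 0 := fun h ↦ by
    have h1 : addOrderOf cK = 1 := by rw [← hb, h, map_zero, addOrderOf_zero]
    rw [hcK_def, he] at h1
    norm_num at h1
  -- (Kum) for `b`
  have hbT : b ∈ kummerOutside W (2 ^ 1) (s ∪ {(Sum.inr u : Place ℚ)} ∪ t) := by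
    refine hKO _ b cK (Finset.mem_union_left t (Finset.mem_union_right s (Finset.mem_singleton_self _))) hb fun v hv w hw ↦ ?_
    haveI : w.asIdeal.LiesOver v.asIdeal := ⟨by rw [← hw, HeightOneSpectrum.under_asIdeal]⟩
    refine hSel hm e w fun q' hq' hq'w ↦ hv ?_
    have hq'p : q'.Prime := Nat.prime_of_mem_primeFactors hq'
    have hq'v : (q' : 𝓞 ℚ) ∈ v.asIdeal := by
      rw [Ideal.LiesOver.over (P := w.asIdeal) (p := v.asIdeal), Ideal.under_def, Ideal.mem_comap, map_natCast]
      exact hq'w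
    have hveq : v = primesEquiv.symm ⟨q', hq'p⟩ := (natCast_prime_mem_iff_eq hq'p _).mp hq'v
    have h := hmem_st q' hq'
    rw [hpl hq'p, ← hveq] at h
    rcases Finset.mem_union.mp h with h | h
    · exact Finset.mem_union_left t (Finset.mem_union_left _ h)
    · exact Finset.mem_union_right _ h
  -- (zero on `s`) for `b`: the divided product `m / q` is NOT primitive (minimality), then Q2 at `λ ∣ q`
  have hbS : ∀ u' ∈ s, galoisCohomology.localization (W.torsionGaloisModule ((2 ^ 1 : ℕ) : ℤ)) u' 1 b = 0 := by
    intro u' hu'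
    obtain ⟨q', hqf, rfl⟩ := Finset.mem_image.mp hu'
    obtain ⟨hq', hq'd⟩ := Finset.mem_filter.mp hqf
    have hq'p : q'.Prime := Nat.prime_of_mem_primeFactors hq'
    haveI : Fact q'.Prime := ⟨hq'p⟩
    obtain ⟨hKolq, hFrobq⟩ := hGr q' hq'
    obtain ⟨hsub, hmul, hnd, -, -, hpf, hnot, -⟩ :=
      KolyvaginDescent.kolSupp_div (Kol := Gross) ⟨hm, hGr⟩ hq'
    obtain ⟨d₀, hσ₀, hS₀, hS₀', hemb₀⟩ := JET.exists_compatible_datum_of_dvd_of_grossCM hK hD hHe 2 Dt β ι hm (fun q hq ↦ (hmK1 q hq).1)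
      (Nat.div_dvd_of_dvd (Nat.dvd_of_mem_primeFactors hq')) e
    -- minimality: `m / q′` has one shallow prime fewer
    have hzero : d₀.kolyvaginClass Nat.prime_two 1 = 0 := by
      refine hvan hsub.1 d₀ hsub.2 fun hP' ↦ ?_
      have h1 := hmin _ hP'
      have h2 : (m / q').primeFactors = m.primeFactors.erase q' := by rw [hpf, Finset.erase_insert hnot]
      rw [h2] at h1
      have h3 := hkk_erase hq' hq'd
      omega
    obtain ⟨w, hq'w⟩ := exists_natCast_mem (K := K) hq'p
    haveI hwv : w.asIdeal.LiesOver (primesEquiv.symm ⟨q', hq'p⟩ : HeightOneSpectrum (𝓞 ℚ)).asIdeal :=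
      liesOver_of_natCast_mem hq'p (hplmem hq'p) hq'w
    have hRel := kolyvaginRelationAtTwo_of_mul_eq W Dt β ι hρ2 hK h3 h4 hHe h37 1 (by rw [mul_comm]; exact hmul) hm hq'p hnd hmK1
      d₀ e hσ₀ hS₀ hS₀' hemb₀ w hq'w 0
    have hRel₀ : cK ∈ (W.baseChange K).torsionLocalKer (w.adicCompletion K) ((2 ^ 1 : ℕ) : ℤ) ↔
        d₀.kolyvaginClass Nat.prime_two 1 ∈ (W.baseChange K).torsionLocalKer (w.adicCompletion K) ((2 ^ 1 : ℕ) : ℤ) := by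
      have h := hRel.2
      simp only [pow_zero, Nat.cast_one, one_smul] at h
      exact h
    rw [hpl hq'p]
    exact localization_eq_zero_of_K_two W hΔ hq'p hKolq.2.2.2.1 (hplmem hq'p)
      (VisiblePairAtTwo.hasGoodReductionAt_of_hasGoodReductionAtPrime W (hasGoodReductionAtPrime_of_not_dvd_conductorNorm W hKolq.2.1)
        (hplmem hq'p))
      h2K hθ hc (intCast_notMem_of_not_dvd hq'p (hplmem hq'p) hKolq.2.2.1) (by rw [pow_one]; exact hFrobq) w
      (inertiaDeg_eq_two_of_span_isPrime h2K hq'p hKolq.2.2.2.2.1 (hplmem hq'p) hq'w) hb hRel₀ hzero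
  -- (transverse on `t`) for `b`: file W4a at the deep own primes
  have hbt : ∀ v : HeightOneSpectrum (𝓞 ℚ), Sum.inr v ∈ t →
      ∀ 𝔓 ∈ v.primesAbove, ∀ F c₀ : absoluteGaloisGroup ℚ, IsArithFrobAt (𝓞 ℚ) F 𝔓 →
        IsComplexConjugation (Rat.castHom ℝ) c₀ → (∀ P : geomTorsion W ((2 ^ 1 : ℕ) : ℤ), F • P = c₀ • P) →
        ∃ P₁ : geomTorsion W ((2 ^ 1 : ℕ) : ℤ), h1Eval W _ b F = F • P₁ - P₁ := by
    intro v hvt 𝔓 h𝔓 F c₀ hF hc₀ hFc₀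
    obtain ⟨q', hqf, h⟩ := Finset.mem_image.mp hvt
    obtain ⟨hq', hq'd⟩ := Finset.mem_filter.mp hqf
    have hq'p : q'.Prime := Nat.prime_of_mem_primeFactors hq'
    rw [hpl hq'p] at h
    have hv : v = primesEquiv.symm ⟨q', hq'p⟩ := (Sum.inr_injective h).symm
    exact hTr_two W hK hodd h3 hΔ Dt β ι m e b hm hmK1 hb v q' hq' (hv ▸ hplmem hq'p) hq'd.2.1 𝔓 h𝔓 F c₀ hF hc₀ hFc₀
  -- ### run the engine
  refine false_of_levelTwo_engine_deep W hCM hin hρ2 hK hHe hθ hc σ hσ u hPu hdesc s t hst hs hus hut hTK cK he hsgn hτcK hbT hbS hbt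
    hb0 fun y _ _ ↦ ⟨∅, ?_⟩
  -- ### the bookkeeping at a deep new prime `ℓ′`
  intro ℓ' v' w' hw'v' _ hℓ'p hℓ'v' hℓ'w' hKol' hFrob4 hidx2 hv'out hOrdZ hOrdY
  haveI hw'l : w'.asIdeal.LiesOver v'.asIdeal := ⟨by rw [← hw'v', HeightOneSpectrum.under_asIdeal]⟩
  have hdeep' : Deep ℓ' := ⟨hKol', hidx2, hFrob4⟩
  have hGross' : Gross ℓ' := ⟨hKol', hFrob4.of_dvd ⟨2, by norm_num⟩⟩
  have hv'eq : v' = primesEquiv.symm ⟨ℓ', hℓ'p⟩ := (natCast_prime_mem_iff_eq hℓ'p _).mp hℓ'v'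
  have hℓ'n : ℓ' ∉ m.primeFactors := fun h ↦ hv'out (by
    rw [hv'eq, ← hpl hℓ'p]
    rcases Finset.mem_union.mp (hmem_st ℓ' h) with h' | h'
    · exact Finset.mem_union_left t (Finset.mem_union_left _ h')
    · exact Finset.mem_union_right _ h')
  have hℓ'dvd : ¬ ℓ' ∣ m := fun h ↦ hℓ'n (Nat.mem_primeFactors.mpr ⟨hℓ'p, h, hm0⟩)
  have hsq : Squarefree (m * ℓ') :=
    (Nat.squarefree_mul ((Nat.Prime.coprime_iff_not_dvd hℓ'p).mpr hℓ'dvd).symm).mpr ⟨hm, hℓ'p.squarefree⟩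
  have hpf' : (m * ℓ').primeFactors = insert ℓ' m.primeFactors := by
    rw [Nat.primeFactors_mul hm0 hℓ'p.ne_zero, hℓ'p.primeFactors, Finset.union_comm]; rfl
  have hGr' : ∀ q ∈ (m * ℓ').primeFactors, Gross q := by
    intro q hq
    rw [hpf', Finset.mem_insert] at hq
    rcases hq with rfl | hq
    · exact hGross'
    · exact hGr q hq
  have hnK' : ∀ q ∈ (m * ℓ').primeFactors, Zhang2014.IsKolyvaginPrime (W.conductorNorm ℤ) W K 2 q ∧ 1 ≤ Zhang2014.kolyvaginIndex W 2 q :=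
    fun q hq ↦ ⟨(hGr' q hq).1, (hGr' q hq).1.2.2.2.2.2⟩
  -- the datum at `mℓ′` (Gross's CM construction) and its class
  obtain ⟨dℓ, hdℓ⟩ := JET.exists_compatible_data_of_grossCM hGrossCM hK hD hHe 2 Dt β ι hm (fun q hq ↦ (hmK1 q hq).1) e
  obtain ⟨hσc, hSc, hSc', hembc⟩ := hdℓ ℓ' hKol' hℓ'n
  set d' := dℓ ℓ' hKol' hℓ'n with hd'_def
  set cK' := d'.kolyvaginClass Nat.prime_two 1 with hcK'_def
  -- (desc): `cK′` is `σ`-fixed mod `2`, hence a restriction from `ℚ`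
  obtain ⟨hsgn', hτcK'⟩ := KolyvaginClassSign.sign_conjAct_kolyvaginClass_two hK h3 h4 hodd hHe hsurj1 σ hσ Dt β ι hsq le_rfl hnK' d'
  obtain ⟨Z, hZ⟩ := (EigenClassesFinite.mem_range_resTorsion_iff_conjAct_eq W K h2K hθ' hθsq _ hL2 cK').mpr
    (conjAct_eq_self_of_sign_two W σ cK' hsgn' hτcK')
  refine ⟨Z, cK', hZ, ?_, ?_, ?_, ?_⟩
  · -- (Kum): `cK′` Selmer at the places not over `mℓ′`
    intro v hv w hwv
    haveI : w.asIdeal.LiesOver v.asIdeal := ⟨by rw [← hwv, HeightOneSpectrum.under_asIdeal]⟩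
    refine hSel hsq d' w fun q' hq' hq'w ↦ hv ?_
    have hq'p : q'.Prime := Nat.prime_of_mem_primeFactors hq'
    have hq'v : (q' : 𝓞 ℚ) ∈ v.asIdeal := by
      rw [Ideal.LiesOver.over (P := w.asIdeal) (p := v.asIdeal), Ideal.under_def, Ideal.mem_comap, map_natCast]
      exact hq'w
    have hveq : v = primesEquiv.symm ⟨q', hq'p⟩ := (natCast_prime_mem_iff_eq hq'p _).mp hq'v
    rw [hpf', Finset.mem_insert] at hq'
    rcases hq' with rfl | hq'
    · rw [hveq, ← hv'eq]; exact Finset.mem_insert_self _ _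
    · refine Finset.mem_insert_of_mem ?_
      have h := hmem_st q' hq'
      rw [hpl hq'p, ← hveq] at h
      rcases Finset.mem_union.mp h with h | h
      · exact Finset.mem_union_left t (Finset.mem_union_left _ h)
      · exact Finset.mem_union_right _ h
  · -- (Q2@w′), `j = 0`
    have h := kolyvaginRelationAtTwo_of_mul_eq W Dt β ι hρ2 hK h3 h4 hHe h37 1 rfl hsq hℓ'p hℓ'dvd hnK' e d' hσc hSc hSc' hembc w'
      hℓ'w' 0
    simp only [pow_zero, Nat.cast_one, one_smul] at h
    exact h
  · -- the shallow own primes: the swapped product `ℓ′·(m/q)` is NOT primitive (minimality), Q2 at `λ ∣ q`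
    intro u' hu'
    obtain ⟨q', hqf, rfl⟩ := Finset.mem_image.mp hu'
    obtain ⟨hq', hq'd⟩ := Finset.mem_filter.mp hqf
    have hq'p : q'.Prime := Nat.prime_of_mem_primeFactors hq'
    obtain ⟨hKolq, hFrobq⟩ := hGr q' hq'
    obtain ⟨hmsq, hqm, hmq, hmdvd, hmpf⟩ := squarefree_div_mul hm hq' hℓ'p hℓ'n
    obtain ⟨d'', hσ'', hS'', hS''', hemb''⟩ := JET.exists_compatible_datum_of_dvd_of_grossCM hK hD hHe 2 Dt β ι hsq
      (fun q hq ↦ (hnK' q hq).1) hmdvd d'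
    set cKu := d''.kolyvaginClass Nat.prime_two 1 with hcKu_def
    obtain ⟨w, hq'w⟩ := exists_natCast_mem (K := K) hq'p
    haveI hwv : w.asIdeal.LiesOver (primesEquiv.symm ⟨q', hq'p⟩ : HeightOneSpectrum (𝓞 ℚ)).asIdeal :=
      liesOver_of_natCast_mem hq'p (hplmem hq'p) hq'w
    have hRel := kolyvaginRelationAtTwo_of_mul_eq W Dt β ι hρ2 hK h3 h4 hHe h37 1 hmq hsq hq'p hqm hnK' d'' d' hσ'' hS'' hS''' hemb''
      w hq'w 0
    have hGr'' : ∀ r ∈ (ℓ' * (m / q')).primeFactors, Gross r := by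
      intro r hr
      rw [hmpf, Finset.mem_insert] at hr
      rcases hr with rfl | hr
      · exact hGross'
      · exact hGr r (Finset.mem_of_mem_erase hr)
    have hM : cKu = 0 := by
      refine hvan hmsq d'' hGr'' fun hP' ↦ ?_
      have h1 := hmin _ hP'
      rw [hmpf] at h1
      have h3 := hkk_insert hq' hq'd hdeep'
      omega
    have hRel₁ : cK' ∈ (W.baseChange K).torsionLocalKer (w.adicCompletion K) ((2 ^ 1 : ℕ) : ℤ) ↔
        cKu ∈ (W.baseChange K).torsionLocalKer (w.adicCompletion K) ((2 ^ 1 : ℕ) : ℤ) := by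
      have h := hRel.2
      simp only [pow_zero, Nat.cast_one, one_smul] at h
      exact h
    exact ⟨_, q', w, hwv, cKu, hpl hq'p, hq'p, hplmem hq'p, intCast_notMem_of_not_dvd hq'p (hplmem hq'p) hKolq.2.2.1, hFrobq,
      inertiaDeg_eq_two_of_span_isPrime h2K hq'p hKolq.2.2.2.2.1 (hplmem hq'p) hq'w, hRel₁, hM⟩
  · -- (tr): file W4a at the deep own primes of `m` (own primes of `mℓ′` as well)
    intro v hvt 𝔓 h𝔓 F c₀ hF hc₀ hFc₀
    obtain ⟨q', hqf, h⟩ := Finset.mem_image.mp hvt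
    obtain ⟨hq', hq'd⟩ := Finset.mem_filter.mp hqf
    have hq'p : q'.Prime := Nat.prime_of_mem_primeFactors hq'
    rw [hpl hq'p] at h
    have hv : v = primesEquiv.symm ⟨q', hq'p⟩ := (Sum.inr_injective h).symm
    exact hTr_two W hK hodd h3 hΔ Dt β ι (m * ℓ') d' Z hsq hnK' hZ v q' (by rw [hpf']; exact Finset.mem_insert_of_mem hq')
      (hv ▸ hplmem hq'p) hq'd.2.1 𝔓 h𝔓 F c₀ hF hc₀ hFc₀

end Summit.BirchSwinnertonDyer.BirchSwinnertonDyer.Theorems.KolyvaginLowerTwo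

end
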